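import Summits.QuantumFields.YangMills.Theorems.VirialFluxGapCentralZeroModeField
import HarnessLib

/-!
# Route `VirialFluxGap` (YangMills): the zero-mode block field ON CONSTANT HISTORIES — the block averages are the common values

Brick (C1-ii) of the central charts for ⟨stmt-QuantumFields-24141⟩.  On a CONSTANT ring history (every slice the constant configuration
`u : Fin 3 → SU(2)`, constant seam `q`) the block averages of ✓`CentralZeroModeField` are the common values: the zero-mode coefficient of block
`k` in direction `a` is `½σ·Im_a(su2Quat u_k)`, that of the seam block is `½σ·Im_a(su2Quat q)` — i.e. on the constant-history cone the zero-mode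
field IS the radial flow with generators `½σ_k·Im A_k`, `½σ₄·Im B` whose action on `F₀` is computed EXACTLY in
✓`ConstantHistoryRadialFlow.hasDerivAt_ringDeficit_const_radial`.

* `zsliceCoeff_const` ∕ `zseamCoeff_const` — the block coefficients on a constant history;
* `im_eq_sum_zUnit` — `Im q = Σ_a Im_a(q)·u_a` (so `Σ_a ½σIm_a(q)·quatMatrix u_a = quatMatrix(½σ·Im q)`, `quatMatrix_half_sigma_im`), the
  bridge from the three frame directions per variable to ONE radial generator (with ✓`sliceFrameDeriv_add_smul`).

HONEST FRAMING: bookkeeping on the constant-history cone; no chart inequality; ⟨24141⟩ stays OPEN; the Yang–Mills mass gap is NOT proved; no summit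
is proved by a line.  THEOREMS ONLY (0 `def`, 0 `sorry`), standard axioms.  Width seat `ym-line-sfw-p2-w3` g58 (cell ym-idea-1, free hands),
`--supports stmt-QuantumFields-24141`.  References: [cite: CosteEtAl1985]; [cite: Luscher1983, §2].
-/

set_option autoImplicit false

noncomputable section

open scoped Matrix BigOperators Quaternion
open Literature.MathematicalPhysics.QuantumFieldTheory hiding SU2
open Literature.MathematicalPhysics.QuantumLattice

namespace Summit.QuantumFields.YangMills.Theorems.VirialFluxGap.FrameDerivative

open Summit.QuantumFields.YangMills.Theorems.FemtoTransferGap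

variable {L : ℕ} [NeZero L]

/-- ★ **Slice-block coefficient on a constant history**: `zsliceCoeff σ k a (const u q) = ½σ·Im_a(su2Quat u_k)`. [cite: CosteEtAl1985] -/
theorem zsliceCoeff_const (σ : ℝ) (k a : Fin 3) (u : Fin 3 → SU2) (q : SU2) :
    zsliceCoeff L σ k a ((fun _ : Fin (2 * L - 1 + 1) => (fun e : Edge 3 L => u e.2), fun _ : Site 3 L => q) :
        (Fin (2 * L - 1 + 1) → GaugeConfig 3 L SU2) × (Site 3 L → SU2)) =
      (1 / 2 : ℝ) * σ * (![(su2Quat (u k)).imI, (su2Quat (u k)).imJ, (su2Quat (u k)).imK] : Fin 3 → ℝ) a := by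
  unfold zsliceCoeff
  have hL : (0 : ℝ) < (L : ℝ) := by exact_mod_cast NeZero.pos L
  have hN : (((2 * L - 1 + 1 : ℕ) : ℝ) * (L : ℝ) ^ 3) ≠ 0 := by positivity
  have hsite : (Fintype.card (Site 3 L) : ℝ) = (L : ℝ) ^ 3 := by
    rw [TwoLattice.Electric.card_site]; push_cast; ring
  simp only [Finset.sum_const, Finset.card_univ, Fintype.card_fin, nsmul_eq_mul]
  rw [hsite]
  field_simp

/-- ★ **Seam-block coefficient on a constant history**: `zseamCoeff σ a (const u q) = ½σ·Im_a(su2Quat q)`. [cite: CosteEtAl1985] -/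
theorem zseamCoeff_const (σ : ℝ) (a : Fin 3) (u : Fin 3 → SU2) (q : SU2) :
    zseamCoeff L σ a ((fun _ : Fin (2 * L - 1 + 1) => (fun e : Edge 3 L => u e.2), fun _ : Site 3 L => q) :
        (Fin (2 * L - 1 + 1) → GaugeConfig 3 L SU2) × (Site 3 L → SU2)) =
      (1 / 2 : ℝ) * σ * (![(su2Quat q).imI, (su2Quat q).imJ, (su2Quat q).imK] : Fin 3 → ℝ) a := by
  unfold zseamCoeff
  have hL : (0 : ℝ) < (L : ℝ) := by exact_mod_cast NeZero.pos L
  have hN : ((L : ℝ) ^ 3) ≠ 0 := by positivity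
  have hsite : (Fintype.card (Site 3 L) : ℝ) = (L : ℝ) ^ 3 := by
    rw [TwoLattice.Electric.card_site]; push_cast; ring
  simp only [Finset.sum_const, Finset.card_univ, nsmul_eq_mul]
  rw [hsite]
  field_simp

omit [NeZero L] in
/-- ★ **The imaginary part in the unit frame**: `Im q = Σ_a Im_a(q)·u_a`. [folklore] -/
theorem im_eq_sum_zUnit (q : ℍ) :
    q.im = ∑ a : Fin 3, (![q.imI, q.imJ, q.imK] : Fin 3 → ℝ) a • zUnit a := by
  rw [Fin.sum_univ_three]
  simp only [zUnit, Matrix.cons_val_zero, Matrix.cons_val_one, Matrix.cons_val]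
  ext <;> simp [Quaternion.im]

omit [NeZero L] in
/-- The radial generator as a combination of the three unit directions: `quatMatrix(½σ·Im q) = Σ_a (½σ·Im_a q)·quatMatrix(u_a)`
(real-linearity of `quatMatrix`). [folklore] -/
theorem quatMatrix_half_sigma_im (σ : ℝ) (q : ℍ) :
    quatMatrix (((1 / 2 : ℝ) * σ) • q.im) =
      ∑ a : Fin 3, (((1 / 2 : ℝ) * σ * (![q.imI, q.imJ, q.imK] : Fin 3 → ℝ) a : ℝ) : ℂ) • quatMatrix (zUnit a) := by
  rw [im_eq_sum_zUnit, Finset.smul_sum]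
  rw [Fin.sum_univ_three, Fin.sum_univ_three]
  simp only [smul_smul]
  -- `quatMatrix` is additive and real-homogeneous
  have hadd : ∀ x y : ℍ, quatMatrix (x + y) = quatMatrix x + quatMatrix y := fun x y => by
    ext i j
    fin_cases i <;> fin_cases j <;> apply Complex.ext <;> simp [quatMatrix] <;> ring
  rw [hadd, hadd, quatMatrix_smul, quatMatrix_smul, quatMatrix_smul]

end Summit.QuantumFields.YangMills.Theorems.VirialFluxGap.FrameDerivative

end
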